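import Summits.RiemannHypothesis.RiemannHypothesis.Theorems.SoloBlindArcLeakage

/-!
# SoloBlind artefact 10b — the sharp constant: Lemma G of the report

Soloist `solo-RiemannHypothesis-blind`, session 12 (paper/window-height.md §9.2, Lemma G; claim C41).
Refines `SoloBlindArcLeakage` (artefact 10) by keeping the factor `∏_{j ≠ k} |k − j| = k!(n−k)!`
in the Lagrange basis bound (`|ℓ_k| ≤ (π/h)^n 2^n / n!` instead of `(π/h)^n`) and using
`n^n / n! ≤ e^n`:

* `soloBlind_arc_leakage_sharp` : for `deg p ≤ n`, `0 < L ≤ 2π`,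
  `(L / (4π (Λ² (n+1)²))) ∫_0^{2π} ‖p(e^{iθ})‖² ≤ ∫_{φ₀}^{φ₀+L} ‖p(e^{iθ})‖²`, `Λ = (4πe/L)^n`;
* `soloBlind_dpss_leakage_floor_sharp` (LEMMA G): for `N ≥ 1`, `0 < W < 1/2`, `deg p < N`,
  `((1−2W)/(2N²))·((1−2W)/(2e))^{2(N−1)} ∫_0^{2π} ‖p‖² ≤ ∫_{2πW}^{2π(1−W)} ‖p‖²`, i.e.
  `1 − λ₀(N, W) ≥ ((1−2W)/(2N²))·((1−2W)/(2e))^{2(N−1)}` for Slepian's `N × N` prolate matrix.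

As for artefact 10: a case of the Turán–Nazarov inequality with explicit constants; not a statement
about ζ; it is the one quantitative input of the report's Theorem D6.
-/

open Complex Polynomial Real MeasureTheory intervalIntegral Finset

namespace Summit.RiemannHypothesis.RiemannHypothesis.Theorems

/-- `∏_{j ≤ n, j ≠ k} |k − j| = k! (n − k)!` for `k ≤ n`. -/
theorem soloBlind_prod_abs_sub (n k : ℕ) (hk : k ≤ n) :
    ∏ j ∈ (range (n + 1)).erase k, |(k : ℝ) - j| = ((k.factorial * (n - k).factorial : ℕ) : ℝ) := by
  have hsplit : (range (n + 1)).erase k = range k ∪ Ico (k + 1) (n + 1) := by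
    ext j; simp only [mem_erase, mem_range, mem_union, mem_Ico]; omega
  have hdisj : Disjoint (range k) (Ico (k + 1) (n + 1)) := by
    rw [Finset.disjoint_left]
    intro j hj hj'
    rw [mem_range] at hj; rw [mem_Ico] at hj'; omega
  rw [hsplit, prod_union hdisj]
  have hl : ∏ j ∈ range k, |(k : ℝ) - j| = (k.factorial : ℝ) := by
    rw [← Nat.descFactorial_self k, Nat.descFactorial_eq_prod_range, Nat.cast_prod]
    refine prod_congr rfl fun j hj => ?_
    rw [mem_range] at hj
    have hjk : (j : ℝ) ≤ k := by exact_mod_cast hj.le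
    rw [Nat.cast_sub hj.le, abs_of_nonneg (by linarith)]
  have hr : ∏ j ∈ Ico (k + 1) (n + 1), |(k : ℝ) - j| = ((n - k).factorial : ℝ) := by
    rw [prod_Ico_eq_prod_range, show n + 1 - (k + 1) = n - k by omega,
      ← Finset.prod_range_add_one_eq_factorial, Nat.cast_prod]
    refine prod_congr rfl fun i _ => ?_
    have hi : (0 : ℝ) ≤ i := Nat.cast_nonneg i
    push_cast
    rw [abs_of_nonpos (by linarith)]
    ring
  rw [hl, hr]; push_cast; ring

/-- Sharper basis bound: `‖ℓ_k(z)‖ ≤ (π/h)^n · 2^n / n!` on the closed unit disc. -/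
theorem soloBlind_basis_bound_sharp (φ h : ℝ) (hh : 0 ≤ h) (n : ℕ) (hn : (n : ℝ) * h ≤ π)
    (hpos : 1 ≤ n → 0 < h)
    (v : ℕ → ℂ) (hv : ∀ j, v j = cexp (I * ((φ + j * h : ℝ) : ℂ)))
    (k : ℕ) (hk : k ∈ range (n + 1)) (z : ℂ) (hz : ‖z‖ ≤ 1) :
    ‖eval z (Lagrange.basis (range (n + 1)) v k)‖ ≤ (π / h) ^ n * 2 ^ n / n.factorial := by
  rw [Lagrange.basis, eval_prod, norm_prod]
  have hkn : k ≤ n := by rw [mem_range] at hk; omega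
  have hcard : ((range (n + 1)).erase k).card = n := by
    rw [card_erase_of_mem hk, card_range]; simp
  have hfac : ∀ j ∈ (range (n + 1)).erase k,
      ‖eval z (Lagrange.basisDivisor (v k) (v j))‖ ≤ (π / h) / |(k : ℝ) - j| := by
    intro j hj
    rw [mem_erase, mem_range] at hj
    obtain ⟨hjk, hjn⟩ := hj
    have hjn' : j ≤ n := by omega
    have hn1 : 1 ≤ n := by omega
    have hh' : 0 < h := hpos hn1
    have hkj : 0 < |(k : ℝ) - j| := by
      rw [abs_pos, sub_ne_zero]; exact_mod_cast (Ne.symm hjk)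
    rw [soloBlind_norm_eval_basisDivisor]
    have hnum : ‖z - v j‖ ≤ 2 := by
      calc ‖z - v j‖ ≤ ‖z‖ + ‖v j‖ := norm_sub_le _ _
        _ ≤ 1 + 1 := by rw [hv j, Complex.norm_exp_I_mul_ofReal]; linarith
        _ = 2 := by norm_num
    have hden := soloBlind_node_chord φ h hh n hn v hv j k hjn' hkn
    have hden_pos : 0 < 2 / π * (|(k : ℝ) - j| * h) := by positivity
    calc ‖z - v j‖ / ‖v k - v j‖ ≤ 2 / (2 / π * (|(k : ℝ) - j| * h)) :=
          div_le_div₀ (by norm_num) hnum hden_pos hden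
      _ = (π / h) / |(k : ℝ) - j| := by field_simp
  have hchoose := Nat.choose_mul_factorial_mul_factorial hkn
  have h2 : (n.factorial : ℝ) ≤ 2 ^ n * ((k.factorial * (n - k).factorial : ℕ) : ℝ) := by
    have hc : (n.choose k : ℝ) ≤ 2 ^ n := by exact_mod_cast Nat.choose_le_two_pow n k
    have hnn : (0 : ℝ) ≤ ((k.factorial * (n - k).factorial : ℕ) : ℝ) := by positivity
    calc (n.factorial : ℝ) = (n.choose k : ℝ) * ((k.factorial * (n - k).factorial : ℕ) : ℝ) := by
          rw [← hchoose]; push_cast; ring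
      _ ≤ 2 ^ n * ((k.factorial * (n - k).factorial : ℕ) : ℝ) := mul_le_mul_of_nonneg_right hc hnn
  have hkpos : (0 : ℝ) < ((k.factorial * (n - k).factorial : ℕ) : ℝ) := by positivity
  have hnpos : (0 : ℝ) < (n.factorial : ℝ) := by positivity
  have hΛ : 0 ≤ (π / h) ^ n := by positivity
  calc ∏ j ∈ (range (n + 1)).erase k, ‖eval z (Lagrange.basisDivisor (v k) (v j))‖
      ≤ ∏ j ∈ (range (n + 1)).erase k, ((π / h) / |(k : ℝ) - j|) :=
        prod_le_prod (fun j _ => norm_nonneg _) hfac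
    _ = (π / h) ^ n / ∏ j ∈ (range (n + 1)).erase k, |(k : ℝ) - j| := by
        rw [prod_div_distrib, prod_const, hcard]
    _ = (π / h) ^ n / ((k.factorial * (n - k).factorial : ℕ) : ℝ) := by rw [soloBlind_prod_abs_sub n k hkn]
    _ ≤ (π / h) ^ n * 2 ^ n / n.factorial := by
        rw [div_le_div_iff₀ hkpos hnpos]
        calc (π / h) ^ n * (n.factorial : ℝ) ≤ (π / h) ^ n * (2 ^ n * ((k.factorial * (n - k).factorial : ℕ) : ℝ)) :=
              mul_le_mul_of_nonneg_left h2 hΛ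
          _ = (π / h) ^ n * 2 ^ n * ((k.factorial * (n - k).factorial : ℕ) : ℝ) := by ring

/-- Sharper interpolation bound: `‖p z‖ ≤ ((π/h)^n 2^n/n!) ∑_k ‖p(v_k)‖`. -/
theorem soloBlind_interp_bound_sharp (φ h : ℝ) (hh : 0 ≤ h) (n : ℕ) (hn : (n : ℝ) * h ≤ π)
    (hpos : 1 ≤ n → 0 < h)
    (v : ℕ → ℂ) (hv : ∀ j, v j = cexp (I * ((φ + j * h : ℝ) : ℂ)))
    (p : ℂ[X]) (hp : p.degree < ((n + 1 : ℕ) : WithBot ℕ)) (z : ℂ) (hz : ‖z‖ ≤ 1) :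
    ‖p.eval z‖ ≤ ((π / h) ^ n * 2 ^ n / n.factorial) * ∑ k ∈ range (n + 1), ‖p.eval (v k)‖ := by
  have hinj : Set.InjOn v (range (n + 1)) := by
    intro j hj k hk hjk
    by_contra hne
    simp only [coe_range, Set.mem_Iio] at hj hk
    have h1 := soloBlind_node_chord φ h hh n hn v hv j k (by omega) (by omega)
    rw [hjk, sub_self, norm_zero] at h1
    have hn1 : 1 ≤ n := by omega
    have hkj : 0 < |(k : ℝ) - j| := by
      rw [abs_pos, sub_ne_zero]
      exact_mod_cast (Ne.symm hne)
    have : 0 < 2 / π * (|(k : ℝ) - j| * h) := by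
      have := hpos hn1
      positivity
    linarith
  have hdeg : p.degree < ((range (n + 1)).card : WithBot ℕ) := by rw [card_range]; exact hp
  have heq := Lagrange.eq_interpolate hinj hdeg
  calc ‖p.eval z‖
      = ‖eval z (Lagrange.interpolate (range (n + 1)) v fun i => p.eval (v i))‖ := by rw [← heq]
    _ = ‖∑ k ∈ range (n + 1), p.eval (v k) * eval z (Lagrange.basis (range (n + 1)) v k)‖ := by
        rw [Lagrange.interpolate_apply, eval_finsetSum]
        simp only [eval_mul, eval_C]
    _ ≤ ∑ k ∈ range (n + 1), ‖p.eval (v k) * eval z (Lagrange.basis (range (n + 1)) v k)‖ :=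
        norm_sum_le _ _
    _ ≤ ∑ k ∈ range (n + 1), ‖p.eval (v k)‖ * ((π / h) ^ n * 2 ^ n / n.factorial) := by
        apply sum_le_sum
        intro k hk
        rw [norm_mul]
        exact mul_le_mul_of_nonneg_left
          (soloBlind_basis_bound_sharp φ h hh n hn hpos v hv k hk z hz) (norm_nonneg _)
    _ = ((π / h) ^ n * 2 ^ n / n.factorial) * ∑ k ∈ range (n + 1), ‖p.eval (v k)‖ := by
        rw [← sum_mul, mul_comm]

/-- `n^n / n! ≤ e^n`, hence `(π/(L/(2n)))^n 2^n / n! ≤ (4πe/L)^n` for `L > 0`. -/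
theorem soloBlind_const_le_exp (n : ℕ) (L : ℝ) (hL : 0 < L) :
    (π / (L / (2 * n))) ^ n * 2 ^ n / n.factorial ≤ (4 * π * Real.exp 1 / L) ^ n := by
  have h1 : ((n : ℝ)) ^ n / n.factorial ≤ Real.exp n := by
    simpa using Real.pow_div_factorial_le_exp (x := (n : ℝ)) (by positivity) n
  have h2 : Real.exp (n : ℝ) = Real.exp 1 ^ n := by
    rw [← Real.exp_nat_mul]; simp
  have hq : π / (L / (2 * n)) = 2 * π * n / L := by
    rw [div_div_eq_mul_div]; ring
  rw [hq]
  have hnn : (0 : ℝ) ≤ (4 * π / L) ^ n := by positivity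
  calc (2 * π * n / L) ^ n * 2 ^ n / n.factorial = (4 * π / L) ^ n * ((n : ℝ) ^ n / n.factorial) := by
        rw [show (2 * π * (n : ℝ) / L) = (4 * π / L) * n / 2 by ring]
        rw [div_pow, mul_pow]
        field_simp
    _ ≤ (4 * π / L) ^ n * Real.exp 1 ^ n := by
        rw [← h2]; exact mul_le_mul_of_nonneg_left h1 hnn
    _ = (4 * π * Real.exp 1 / L) ^ n := by rw [← mul_pow]; ring

/-- **Leakage inequality, sharp constant.** For `deg p ≤ n`, `0 < L ≤ 2π`, `Λ = (4πe/L)^n`: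
`(L / (4π (Λ² (n+1)²))) ∫_0^{2π} ‖p(e^{iθ})‖² dθ ≤ ∫_{φ₀}^{φ₀+L} ‖p(e^{iθ})‖² dθ`. -/
theorem soloBlind_arc_leakage_sharp (p : ℂ[X]) (n : ℕ) (hp : p.degree < ((n + 1 : ℕ) : WithBot ℕ))
    (φ₀ L : ℝ) (hL : 0 < L) (hL' : L ≤ 2 * π) :
    L / (4 * π * (((4 * π * Real.exp 1 / L) ^ n) ^ 2 * ((n : ℝ) + 1) ^ 2)) *
        ∫ θ in (0 : ℝ)..(2 * π), ‖p.eval (cexp (I * θ))‖ ^ 2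
      ≤ ∫ θ in φ₀..(φ₀ + L), ‖p.eval (cexp (I * θ))‖ ^ 2 := by
  set Λ := (4 * π * Real.exp 1 / L) ^ n with hΛ
  have hΛpos : 0 < Λ := by positivity
  have hh : 0 ≤ L / (2 * n) := by positivity
  have hnπ : (n : ℝ) * (L / (2 * n)) ≤ π := by
    rcases Nat.eq_zero_or_pos n with hn0 | hnpos
    · simp [hn0]; positivity
    · have hn' : (n : ℝ) ≠ 0 := by positivity
      have : (n : ℝ) * (L / (2 * n)) = L / 2 := by field_simp
      rw [this]; linarith
  have hpos : 1 ≤ n → 0 < L / (2 * n) := by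
    intro hn1
    have : (0 : ℝ) < n := by exact_mod_cast hn1
    positivity
  have hΛ' : (π / (L / (2 * n))) ^ n * 2 ^ n / n.factorial ≤ Λ := soloBlind_const_le_exp n L hL
  have hΛ'nn : 0 ≤ (π / (L / (2 * n))) ^ n * 2 ^ n / n.factorial := by positivity
  refine soloBlind_arc_leakage_of_sup p φ₀ L _ hL (by positivity) fun θ => ?_
  refine soloBlind_arc_sup_of_interp p n φ₀ L hL Λ _ fun t => ?_
  set v : ℕ → ℂ := fun j => cexp (I * ((φ₀ + t + j * (L / (2 * n)) : ℝ) : ℂ)) with hv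
  have hz : ‖cexp (I * θ)‖ ≤ 1 := by rw [Complex.norm_exp_I_mul_ofReal]
  have hb := soloBlind_interp_bound_sharp (φ₀ + t) (L / (2 * n)) hh n hnπ hpos v (fun j => rfl)
    p hp _ hz
  have hS : 0 ≤ ∑ k ∈ range (n + 1), ‖p.eval (v k)‖ := sum_nonneg fun k _ => norm_nonneg _
  have hb' : ‖p.eval (cexp (I * θ))‖ ≤ Λ * ∑ k ∈ range (n + 1), ‖p.eval (v k)‖ :=
    hb.trans (mul_le_mul_of_nonneg_right hΛ' hS)
  have hsq : ‖p.eval (cexp (I * θ))‖ ^ 2 ≤ (Λ * ∑ k ∈ range (n + 1), ‖p.eval (v k)‖) ^ 2 :=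
    pow_le_pow_left₀ (norm_nonneg _) hb' 2
  have hcs : (∑ k ∈ range (n + 1), ‖p.eval (v k)‖) ^ 2
      ≤ ((range (n + 1)).card : ℝ) * ∑ k ∈ range (n + 1), ‖p.eval (v k)‖ ^ 2 :=
    sq_sum_le_card_mul_sum_sq
  rw [card_range] at hcs
  push_cast at hcs
  calc ‖p.eval (cexp (I * θ))‖ ^ 2 ≤ (Λ * ∑ k ∈ range (n + 1), ‖p.eval (v k)‖) ^ 2 := hsq
    _ = Λ ^ 2 * (∑ k ∈ range (n + 1), ‖p.eval (v k)‖) ^ 2 := by ring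
    _ ≤ Λ ^ 2 * (((n : ℝ) + 1) * ∑ k ∈ range (n + 1), ‖p.eval (v k)‖ ^ 2) :=
        mul_le_mul_of_nonneg_left hcs (by positivity)

/-- **LEMMA G (DPSS leakage floor, sharp form).** For `N ≥ 1`, `0 < W < 1/2` and every complex
polynomial `p` of degree `< N`:
`((1−2W)/(2N²))·((1−2W)/(2e))^{2(N−1)} ∫_0^{2π} ‖p(e^{iθ})‖² ≤ ∫_{2πW}^{2π(1−W)} ‖p(e^{iθ})‖²`,
i.e. `1 − λ₀(N, W) ≥ ((1−2W)/(2N²))·((1−2W)/(2e))^{2(N−1)}` for Slepian's prolate matrix. -/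
theorem soloBlind_dpss_leakage_floor_sharp (N : ℕ) (hN : 1 ≤ N) (W : ℝ) (hW0 : 0 < W)
    (hW : W < 1 / 2) (p : ℂ[X]) (hp : p.degree < (N : WithBot ℕ)) :
    (1 - 2 * W) / (2 * (N : ℝ) ^ 2) * ((1 - 2 * W) / (2 * Real.exp 1)) ^ (2 * (N - 1)) *
        ∫ θ in (0 : ℝ)..(2 * π), ‖p.eval (cexp (I * θ))‖ ^ 2
      ≤ ∫ θ in (2 * π * W)..(2 * π * (1 - W)), ‖p.eval (cexp (I * θ))‖ ^ 2 := by
  obtain ⟨n, rfl⟩ : ∃ n, N = n + 1 := ⟨N - 1, by omega⟩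
  have hw : 0 < 1 - 2 * W := by linarith
  have hL : 0 < 2 * π * (1 - 2 * W) := by positivity
  have hL' : 2 * π * (1 - 2 * W) ≤ 2 * π := by nlinarith [Real.pi_pos]
  have key := soloBlind_arc_leakage_sharp p n hp (2 * π * W) (2 * π * (1 - 2 * W)) hL hL'
  rw [show 2 * π * W + 2 * π * (1 - 2 * W) = 2 * π * (1 - W) by ring] at key
  refine le_trans (le_of_eq ?_) key
  congr 1
  have hπ : (π : ℝ) ≠ 0 := Real.pi_pos.ne'
  have hw' : (1 - 2 * W) ≠ 0 := hw.ne'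
  have he : Real.exp 1 ≠ 0 := (Real.exp_pos 1).ne'
  simp only [Nat.cast_add, Nat.cast_one, Nat.add_sub_cancel]
  have hq : 4 * π * Real.exp 1 / (2 * π * (1 - 2 * W)) = 2 * Real.exp 1 / (1 - 2 * W) := by
    field_simp
    ring
  rw [hq, ← pow_mul, show n * 2 = 2 * n by ring, div_pow, div_pow]
  field_simp
  ring

end Summit.RiemannHypothesis.RiemannHypothesis.Theorems
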